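import Summits.CriticalPhenomena.PercolationContinuityZ3.Theorems.PercNearOneGluingNoHeavyLowerTailNineTypeCount
import Summits.CriticalPhenomena.PercolationContinuityZ3.Theorems.PercNearOneGluingNoHeavyLowerTailNineTypeCellCount

/-!
# The full nine-type kernel is good — `Q44b` holds on every finite weighted graph (all `n`)

Support file for crux `stmt-CriticalPhenomena-4575` (`Q44b`, GF(2)-rank line of `prim-bnk-1`), seat `prim-bnk-1` gen 19;
memo `run/shared/lean/prim/prim-l12/FROM-prim-bnk-1-gen19-HALL-GRAM-ASSEMBLY.md` §14.

* `TwoCopyMono.goodKernel_kerS_all`: for EVERY `S ⊆ {1,…,9}` the nine-type kernel `kerS S` is a good kernel — the fibre statement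
  of the OTA programme with all nine types (`prim-bnk-1` g17 Conjecture R), from the nine-type count
  `NineType.card_bad_le_card_good` (`…NineTypeCount`) through the cell-count bridge `goodKernel_kerS_iff_cellCount`.
* `TwoCopyMono.q44b_pack_all`: the packing `Σ_{θ ∈ S} cell(h θ)·cell(l θ) ≤ (cell(ab|cy) + cell(abcy))·cell(a|b|c|y)` for every
  `S ⊆ {1,…,9}`, every finite weighted graph and all marked points.
* **`Q44b.row_nonneg_all : 0 ≤ Q44b.row w a b c y`** for every `n`, every weighting `w : Sym2 (Fin n) → [0,1]` and all
  `a b c y : Fin n` — `Q44b` for all `n`, unconditionally (via `Q44b.row_nonneg_of_goodKernel`); previously in the tree only for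
  bounded `n` / under certificates (`row_nonneg_of_cellCount`, `row_nonneg_of_listCerts`, `row_nonneg_of_antipodal`, …).
Pure finite combinatorics + the existing two-copy bridge; no named facts, no sorries, standard axioms.
-/

namespace Summit.CriticalPhenomena.PercolationContinuityZ3.Theorems

namespace TwoCopyMono

open Finset FourPointAtoms

/-- **Every nine-type kernel is good**: for all `S ⊆ {1,…,9}`, `GoodKernel (kerS S)`. [this work] -/
theorem goodKernel_kerS_all (S : Finset ℕ) (hS : ∀ θ ∈ S, 1 ≤ θ ∧ θ ≤ 9) : GoodKernel (kerS S) := by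
  classical
  rw [goodKernel_kerS_iff_cellCount]
  intro γ _ _ ι hmono
  set 𝒯 : Finset (Finset γ) := Finset.univ.filter (fun T => badS S (ι T) (ι Tᶜ)) with h𝒯
  set 𝔊 : Finset (Finset γ) := Finset.univ.filter (fun T => isAC (ι T) ∧ ι Tᶜ = 0) with h𝔊
  have h𝔊mem : ∀ T, T ∈ 𝔊 ↔ isAC (ι T) ∧ ι Tᶜ = 0 := by
    intro T; rw [h𝔊, Finset.mem_filter]; simp
  obtain ⟨θf, hθS, hθ9, hθh, hθl⟩ := exists_typeFun S hS ι 𝒯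
    (fun T hT => by rw [h𝒯, Finset.mem_filter] at hT; exact hT.2)
  have hθ : ∀ t ∈ 𝒯, 1 ≤ θf t ∧ θf t ≤ 9 := fun t ht => hS _ (hθS t ht)
  have hcont := cellMap_cont ι hmono 𝒯 θf hθ9 hθh hθl
  have hcov' := cellMap_union_ne_univ ι hmono 𝒯 θf hθ9 hθh hθl
  have hcov : ∀ s ∈ 𝒯, ∀ s' ∈ 𝒯, s ≠ s' → s ∪ s' ≠ Finset.univ := fun s hs s' hs' _ => hcov' s hs s' hs'
  have hGup : IsUpperSet (𝔊 : Set (Finset γ)) := cellMap_goods_upper ι hmono 𝔊 h𝔊mem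
  have hG : ∀ g ∈ 𝔊, ∀ g' : Finset γ, g ⊆ g' → g' ∈ 𝔊 := fun g hg g' hgg' => hGup hgg' hg
  have hHL := cellMap_hl_good ι hmono 𝒯 θf 𝔊 hθ9 hθh hθl h𝔊mem
  have hHH' := cellMap_hh_good ι hmono 𝒯 θf 𝔊 hθ9 hθh hθl h𝔊mem
  have hHH : ∀ s ∈ 𝒯, ∀ s' ∈ 𝒯, s ≠ s' → NineType.hhOK (θf s) (θf s') = true → s ∪ s' ∈ 𝔊 :=
    fun s hs s' hs' _ hok => hHH' s hs s' hs' hok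
  exact NineType.card_bad_le_card_good 𝒯 θf hθ hcont hcov 𝔊 hG hHL hHH

/-! ## Law level -/

variable {n : ℕ}

/-- **Packing of any set of types**: for every `S ⊆ {1,…,9}`, every finite weighted graph and all marked points,
`Σ_{θ ∈ S} cell(h θ)·cell(l θ) ≤ (cell(ab|cy) + cell(abcy))·cell(a|b|c|y)`. [this work] -/
theorem q44b_pack_all (S : Finset ℕ) (hS : ∀ θ ∈ S, 1 ≤ θ ∧ θ ≤ 9)
    (w : Sym2 (Fin n) → unitInterval) (a b c y : Fin n) :
    ∑ θ ∈ S, cell w a b c y (hIdx θ) * cell w a b c y (lIdx θ) ≤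
      (cell w a b c y 11 + cell w a b c y 14) * cell w a b c y 0 := by
  have h := sum_kernel_cell_nonneg (goodKernel_kerS_all S hS) w a b c y
  rw [sum_kerS_cell S hS] at h
  linarith

/-- **`Q44b` in cells, all nine products, for every finite weighted graph (all `n`):**
`P(ab|cy)·[P(ac|by)+P(ay|bc)] + P(ab|c|y)·[P(ac|by)+P(ay|bc)+P(a|b|cy)+P(acy|b)+P(a|bcy)] + P(a|bcy)·[P(ac|b|y)+P(ay|b|c)]
≤ [P(ab|cy)+P(abcy)]·P(a|b|c|y)`. [this work] -/
theorem q44b_pack_nine (w : Sym2 (Fin n) → unitInterval) (a b c y : Fin n) :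
    cell w a b c y 11 * (cell w a b c y 9 + cell w a b c y 8) +
      cell w a b c y 6 * (cell w a b c y 9 + cell w a b c y 8 + cell w a b c y 1 + cell w a b c y 10 +
        cell w a b c y 7) +
      cell w a b c y 7 * (cell w a b c y 5 + cell w a b c y 4) ≤
      (cell w a b c y 11 + cell w a b c y 14) * cell w a b c y 0 := by
  have h := q44b_pack_all ({1, 2, 3, 4, 5, 6, 7, 8, 9} : Finset ℕ) (by decide) w a b c y
  have he : (∑ θ ∈ ({1, 2, 3, 4, 5, 6, 7, 8, 9} : Finset ℕ),
      cell w a b c y (hIdx θ) * cell w a b c y (lIdx θ)) =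
      cell w a b c y 11 * (cell w a b c y 9 + cell w a b c y 8) +
      cell w a b c y 6 * (cell w a b c y 9 + cell w a b c y 8 + cell w a b c y 1 + cell w a b c y 10 +
        cell w a b c y 7) +
      cell w a b c y 7 * (cell w a b c y 5 + cell w a b c y 4) := by
    rw [Finset.sum_insert (by decide), Finset.sum_insert (by decide), Finset.sum_insert (by decide),
      Finset.sum_insert (by decide), Finset.sum_insert (by decide), Finset.sum_insert (by decide),
      Finset.sum_insert (by decide), Finset.sum_insert (by decide), Finset.sum_singleton]
    simp only [hIdx, lIdx]
    norm_num
    ring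
  linarith

end TwoCopyMono

/-! ## `Q44b` for all `n` -/

namespace Q44b

/-- **`Q44b` for every finite weighted graph.**  For every `n`, every edge weighting `w : Sym2 (Fin n) → [0,1]` of the complete
graph and all vertices `a b c y`, the `Q44b` row
`P(AC)·P(∅) − P(AΔ)·P(X) − P(ab|c|y)·P(C¬A) − P(a|bcy)·P(X′)` of the Bernoulli bond percolation `P = P_w` is non-negative.
Unconditional; all `n`. [this work: `row_nonneg_of_goodKernel` + `TwoCopyMono.goodKernel_kerS_all`] -/
theorem row_nonneg_all {n : ℕ} (w : Sym2 (Fin n) → unitInterval) (a b c y : Fin n) : 0 ≤ row w a b c y :=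
  row_nonneg_of_goodKernel w a b c y
    (TwoCopyMono.goodKernel_kerS_all _ (fun _ hθ => Finset.mem_Icc.1 hθ))

end Q44b

end Summit.CriticalPhenomena.PercolationContinuityZ3.Theorems
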